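import Summits.Langlands.Langlands.Theses.DeterminantTowerSplit

/-!
# Route DeterminantTowerSplit — Assembly

The assembly item (stmt-Langlands-27170) of the child route `DeterminantTowerSplit` (decomp-langlands lens-3 gen 16; a gate-native D-0170
refining child: `--refines route-Langlands-RootDecomp1:AccessibleAvatars`, edge split, depth 1, no FRAME item) for the crux
Acc = `RootDecomp1.AccessibleAvatars` (stmt-Langlands-29148):
`IntegralFrobeniusData → DeterminantTowerAvatars → TowerRealisation → RootDecomp1.AccessibleAvatars`.

This is literally the type of the route file's sorry-free deciding theorem `Summit.Langlands.Langlands.Theses.DeterminantTowerSplit.closes`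
(lens-3's one EQUIV: the accessible semisimple ℓ-adic avatar ⟺ integral Frobenius data ∧ a Λ-adic determinant tower, through the print
support TR).  Nothing here proves `Langlands` (nor Acc): the assembly records only that the three ledger items of the route, taken together,
imply the refined crux.
-/

set_option linter.dupNamespace false -- project-wide option (lakefile weak.linter.dupNamespace); `Summit.Langlands.Langlands` is the mandated namespace

namespace Summit.Langlands.Langlands.Theorems

/-- **Assembly of route DeterminantTowerSplit** (stmt-Langlands-27170): `INT → DEPTH → TR → RootDecomp1.AccessibleAvatars`.
Proof: unfold `Assembly` and apply the route's deciding theorem `Theses.DeterminantTowerSplit.closes`. -/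
theorem determinantTowerSplit_assembly_proof :
    Summit.Langlands.Langlands.Theses.DeterminantTowerSplit.Assembly := by
  unfold Summit.Langlands.Langlands.Theses.DeterminantTowerSplit.Assembly
  exact Summit.Langlands.Langlands.Theses.DeterminantTowerSplit.closes

end Summit.Langlands.Langlands.Theorems
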